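import Literature.Geometry.Lorentzian.FinalEraPackage2
import HarnessLib

/-!
# Restatement proposals for crux stmt-FinalStateConjecture-17643 `DispersingCapture` (lead prover,
# line `birth`/`registered`, 2026-08-17) — ELABORATION-CHECKED CLAUSES FOR THE PLANNER, not proposed anywhere

Why: stub B₊ (`stub_boostedCapturePos`) of `Lines/birth.lean` is not derivable by bookkeeping from the
31-clause package `IsFinalEra₂` (see `Lines/birth.dead.md`): (F3) forces every witness `d` to thin the
flat chart, (X4) lets the hole clock lag the flat clock, and (EX) exempts `U₀`-flat-late points, so band
points with hole time `≤ τ₁ <` flat time are in nobody's certified-late region and no clause yields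
`p ∈ J⁻(certifiedSlab d R τ₁)`. Two repairs, both to be absorbed by `FinalEraGeneric`'s package (and
hence by the hypotheses of `RadiativeLyapunovBudget` / `DispersingCapture`):

* `CauchyDevelopment.RobustExhaustion` — option (a): ADD the two-parameter robust exhaustion clause (EX′)
  to the package (minimal change; B₊ then goes through with a step-function thinning radius and diagonal
  placement of the steps, XL but honest bookkeeping).
* `CauchyDevelopment.StatementShapedExhaustion` — option (b, recommended): let the package CARRY the
  rest-frame exhaustion data in the Statement's own shape (drifting sublinear flat tubes, full-slab
  flatness, honest growing radii with convergence, exhaustion verbatim `certifiedLate`/`certifiedSlab`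
  with motions `(1,0)`), replacing (F2), (F3), (F₀)'s far-restriction and (EX); B is then boost transport.

CAVEAT: constant hole radius with growing flat tubes is dishonest (late uncertified annulus); radii and
tubes must grow together — that coupling of the two clocks is the physical content the package must carry.
-/

noncomputable section

open Set TopologicalSpace Filter MeasureTheory
open scoped Manifold ContDiff Topology ENNReal Function

namespace Literature.Geometry.Lorentzian

variable {X : Type} [TopologicalSpace X] [ChartedSpace E3 X] [IsManifold (𝓡 3) ∞ X]
  [ConnectedSpace X] {D : InitialDataSet (𝓡 3) X}

/-- (EX′) ROBUST EXHAUSTION — option (a) of the restatement: for every thinning radius `ϱ ≥ ρ₀` of the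
flat region and every hole-zone radius `R ≥ max (2ρ₀) (C₂ϱ + C₁)`, eventually in chart time `τ₁`, every
point of `O` which is neither in the FAR flat late region `Ψ₀({y⁰ > τ₁, distᵢ > ϱ ∀ i})` nor in a hole
zone `Ψᵢ({t*ᵢ > τ₁, rᵢ ≤ R})` lies in the causal past of the far flat slab at `τ₁` union the hole slabs
`{t*ᵢ = τ₁, rᵢ ≤ R}`. -/
def CauchyDevelopment.RobustExhaustion (𝒟 : CauchyDevelopment D) (N : ℕ) (T C₁ C₂ ρ₀ : ℝ)
    (ξ : Fin N → ℝ → E3) (B₀ : ModelBackground) (B : Fin N → ModelBackground)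
    (Ψ₀ : B₀.domain → 𝒟.carrier) (Ψ : (i : Fin N) → (B i).domain → 𝒟.carrier)
    (O : Set 𝒟.carrier) : Prop :=
  ∀ ϱ R : ℝ, ρ₀ ≤ ϱ → max (2 * ρ₀) (C₂ * ϱ + C₁) ≤ R → ∃ T₁ : ℝ, T ≤ T₁ ∧ ∀ τ₁, T₁ < τ₁ →
    O \ (Ψ₀ '' {y : B₀.domain | τ₁ < y.1 0 ∧ ∀ i, ϱ < ‖E4.spatial y.1 - ξ i (y.1 0)‖} ∪
          ⋃ i, Ψ i '' (B i).truncLateRegion τ₁ R) ⊆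
      𝒟.toSpacetime.metric.causalPast 𝒟.toSpacetime.timeOrientation
        (Ψ₀ '' {y : B₀.domain | y.1 0 = τ₁ ∧ ∀ i, ϱ < ‖E4.spatial y.1 - ξ i τ₁‖} ∪
          ⋃ i, Ψ i '' (B i).truncTimeSlab R τ₁)

/-- Option (b) of the restatement — make the package CARRY the rest-frame exhaustion data in the
Statement's own shape: a drifting sublinear flat tube profile `ρ ≥ ρ₀` with (F2″) `U₀ ⊇ {t > T} ∖ ⋃ᵢ
{dist ≤ ρ(t)}`, (F3″) FULL-slab `C²` flatness on `U₀`, (F₀″) orientation on full late flat slabs, honest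
growing hole radii `Rᵢ` with convergence out to `Rᵢ(τ)`, and (EX″) exhaustion of `O` for every `τ₁ > T`
by `Ψ₀({y⁰ > τ₁})` and the growing zones `Ψᵢ({t*ᵢ > τ₁, rᵢ ≤ Rᵢ(t*ᵢ)})` up to `J⁻` of the slab
`Ψ₀({y⁰ = τ₁}) ∪ ⋃ᵢ Ψᵢ({t*ᵢ = τ₁, rᵢ ≤ Rᵢ(τ₁)})` — verbatim `certifiedLate`/`certifiedSlab` of
`HasExhaustiveCharts` with motions `(1, 0)` and tubes around the drifting `ξᵢ` instead of straight lines
(cf. the hypotheses `hU₀`, `hflat`, `hholes`, `hexh` of `stub_settlesOfConverges`,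
Theorems/ClusterCompletenessLinearToNonlinearCaptureStubSettlesOfConverges.lean). With it the crux's
bookkeeping is boost transport only (hole slabs are the same sets; the straight tube of radius
`ρ(t) + ‖ξᵢ(t) − vᵢt − cᵢ‖ + |aᵢ| + …` is still sublinear by the Cesàro velocities). -/
def CauchyDevelopment.StatementShapedExhaustion (𝒟 : CauchyDevelopment D) (N : ℕ) (M a : Fin N → ℝ)
    (T ρ₀ : ℝ) (ρ : ℝ → ℝ) (R : Fin N → ℝ → ℝ) (ξ : Fin N → ℝ → E3) (U₀ : Opens E4)
    (B : Fin N → ModelBackground) (Ψ₀ : (Minkowski.backgroundOn U₀).domain → 𝒟.carrier)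
    (Ψ : (i : Fin N) → (B i).domain → 𝒟.carrier) (O : Set 𝒟.carrier) : Prop :=
  (∀ t, ρ₀ ≤ ρ t) ∧ Tendsto (fun t ↦ ρ t / t) atTop (𝓝 0) ∧
  {y : E4 | T < y 0 ∧ ∀ i, ρ (y 0) < ‖E4.spatial y - ξ i (y 0)‖} ⊆ (U₀ : Set E4) ∧
  Tendsto (fun τ ↦ 𝒟.toSpacetime.deviationCk (Minkowski.backgroundOn U₀) Ψ₀ 2 τ) atTop (𝓝 0) ∧
  (∀ᶠ τ in atTop, ∀ x ∈ (Minkowski.backgroundOn U₀).timeSlab τ,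
    𝒟.toSpacetime.timeOrientation.IsFutureDirected
      (mfderiv 𝓘(ℝ, E4) (𝓡 4) Ψ₀ x (E4.basisVector 0))) ∧
  (∀ i, Tendsto (R i) atTop atTop ∧ ∀ τ, max (Kerr.rPlus (M i) (a i)) 0 + 1 ≤ R i τ) ∧
  (∀ i, Tendsto (fun τ ↦ 𝒟.toSpacetime.truncDeviationCk (B i) (Ψ i) 2 (R i τ) τ) atTop (𝓝 0)) ∧
  (∀ τ₁, T < τ₁ →
    O \ (Ψ₀ '' (Minkowski.backgroundOn U₀).lateRegion τ₁ ∪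
          ⋃ i, Ψ i '' {x | τ₁ < (B i).time x.1 ∧ (B i).radius x.1 ≤ R i ((B i).time x.1)}) ⊆
      𝒟.toSpacetime.metric.causalPast 𝒟.toSpacetime.timeOrientation
        (Ψ₀ '' (Minkowski.backgroundOn U₀).timeSlab τ₁ ∪
          ⋃ i, Ψ i '' (B i).truncTimeSlab (R i τ₁) τ₁))

end Literature.Geometry.Lorentzian

end
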